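import Mathlib
import HarnessLib
import Summits.KontsevichZagierPeriods.KontsevichZagierPeriods.Theses.HurwitzMicroSectors
import Literature.NumberTheory.Transcendental.BoxIntegralHurwitz
import Literature.NumberTheory.Transcendental.BoxCoordinatePowerMap

/-!
# Sketch — crux-ideate stmt-KontsevichZagierPeriods-3873 (AperySectorThreeTwo), round 1, ideator 1

**STATUS (lean check rc 0, 0 sorries, 2026-08-16): this file PROVES the crux.**
`aperySectorThreeTwo_holds : Theses.HurwitzMicroSectors.AperySectorThreeTwo` (audit class
`proof-of-item`, closed) and, on the way, `dilationMove_direct : Theses.HurwitzMicroSectors.DilationMove`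
(stmt-3872, re-derived from the Literature `coordPow` API). A prover can land it verbatim under
`Summits/KontsevichZagierPeriods/KontsevichZagierPeriods/Theorems/` (planners do not propose proofs).

Idea `jacobian-absorption-fixed-box`: the whole weight-3 level-2 sector closes on ONE domain
(the open box) by rules (1b) integrand additivity + (2) change of variables ONLY:
* `MonomialAbsorption` — `(k+1)³·tᵏ` is the Jacobian of `xᵢ ↦ xᵢ^(k+1)`, so `[c·tᵏ] ∼ [c/(k+1)³]`
  in ONE dilation applied to a CONSTANT (from the route item `DilationMove`);
* `PolarDeflation` — `[8c·t/(1−t²)] ∼ [c/(1−t)]`, ONE dilation `m = 2`;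
* `ReductionThreeTwo` — Euclidean division of `P` by `X² − 1` + the two absorptions + finite
  integrand additivity: PROVED (`reductionThreeTwo`, section `Reduction`: `polar_base`, `poly_fan`,
  `poly_const`, fixed-box rep constructors `secRep`/`polyRep`/`nrmRep`/`cstRep`);
* `apery_of_reduction : ReductionThreeTwo → AperySectorThreeTwo` — rigidity and glue from the
  tree (`box_integral_normalForm_weight_three`, `normalForm_weight_three_coeff_eq`,
  `KZ.Equivalent.value_eq_holds`), PROVED;
* `LevelTwoKernelForm` — the Transfer C⁺ (kernel form, uniform in the weight `n`), statement only.
No Newton–Leibniz move, no domain other than the open box, no Tarski–Seidenberg fact is used.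
-/

noncomputable section

set_option linter.dupNamespace false

open MeasureTheory Set MvPolynomial
open Literature.NumberTheory.Transcendental Literature.ModelTheory.ExponentialFields

namespace Summit.KontsevichZagierPeriods.KontsevichZagierPeriods.Cruxes.AperySectorThreeTwo.JacobianAbsorption

open Summit.KontsevichZagierPeriods.KontsevichZagierPeriods.Theses.HurwitzMicroSectors
  (DilationMove AperySectorThreeTwo)

/-- The open unit box of `Fin 3 → ℝ`, in the literal shape of the crux. -/
abbrev box3 : Set (Fin 3 → ℝ) := {x | ∀ i, x i ∈ Set.Ioo (0:ℝ) 1}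

/-! ## First lemma (L1): monomial absorption — one dilation applied to a constant -/

/-- **L1 MonomialAbsorption.** On the open box, `c·(x₀x₁x₂)ᵏ` and the CONSTANT `c/(k+1)³` are
KZ-equivalent by ONE change of variables `xᵢ ↦ xᵢ^(k+1)` (Jacobian `(k+1)³ ∏ xᵢᵏ`): the monomial
IS the dilated constant. No Newton–Leibniz, no change of dimension. -/
def MonomialAbsorption : Prop :=
  ∀ (k : ℕ) (c : ℚ) (r r' : KZ.IntegralRep 3),
    r.domain = box3 → r'.domain = box3 →
    Set.EqOn r.integrand (fun x => (c : ℝ) * (x 0 * x 1 * x 2) ^ k) r.domain →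
    Set.EqOn r'.integrand (fun _ => (c : ℝ) / ((k : ℝ) + 1) ^ 3) r'.domain →
    KZ.Equivalent r r'

/-- L1 holds given the route item `DilationMove` (instance `n = 3`, `m = k + 1`; `DilationMove` is
proved sorry-free as `dilationMove_holds` in `Cruxes/DilationMove/Disproof.lean`). -/
theorem monomialAbsorption (hD : DilationMove) : MonomialAbsorption := by
  intro k c r r' hr hr' hf hf'
  refine KZ.changeOfVariablesRel_subset_relations
    (hD 3 (k + 1) (by omega) r r' hr hr' ?_)
  intro x hx
  have hxb : ∀ i, x i ∈ Set.Ioo (0:ℝ) 1 := by rw [hr] at hx; exact hx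
  have hx' : (fun i => x i ^ (k + 1)) ∈ r'.domain := by
    rw [hr']
    intro i
    exact ⟨pow_pos (hxb i).1 _, pow_lt_one₀ (hxb i).1.le (hxb i).2 (Nat.succ_ne_zero k)⟩
  rw [hf hx, hf' hx']
  simp only [Nat.add_sub_cancel, Fin.prod_univ_three]
  push_cast
  have hk : ((k : ℝ) + 1) ≠ 0 := by positivity
  field_simp
  ring

/-! ## L2: polar deflation — one dilation `m = 2` -/

/-- **L2 PolarDeflation.** On the open box, `8c·t/(1−t²)` and `c/(1−t)` (`t = x₀x₁x₂`) are
KZ-equivalent by ONE change of variables `xᵢ ↦ xᵢ²` (Jacobian `8t`): the level-2 distribution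
relation `H₀ + H₁ ∼ 8H₁` realised inside rule (2), with the rational scalar riding in the integrand. -/
def PolarDeflation : Prop :=
  ∀ (c : ℚ) (r r' : KZ.IntegralRep 3),
    r.domain = box3 → r'.domain = box3 →
    Set.EqOn r.integrand
      (fun x => 8 * (c : ℝ) * (x 0 * x 1 * x 2) / (1 - (x 0 * x 1 * x 2) ^ 2)) r.domain →
    Set.EqOn r'.integrand (fun x => (c : ℝ) / (1 - x 0 * x 1 * x 2)) r'.domain →
    KZ.Equivalent r r'

/-- L2 holds given `DilationMove` (instance `n = 3`, `m = 2`). -/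
theorem polarDeflation (hD : DilationMove) : PolarDeflation := by
  intro c r r' hr hr' hf hf'
  refine KZ.changeOfVariablesRel_subset_relations
    (hD 3 2 (by norm_num) r r' hr hr' ?_)
  intro x hx
  have hxb : ∀ i, x i ∈ Set.Ioo (0:ℝ) 1 := by rw [hr] at hx; exact hx
  have hx' : (fun i => x i ^ 2) ∈ r'.domain := by
    rw [hr']
    intro i
    exact ⟨pow_pos (hxb i).1 _, pow_lt_one₀ (hxb i).1.le (hxb i).2 two_ne_zero⟩
  rw [hf hx, hf' hx']
  simp only [Fin.prod_univ_three]
  have h01 : x 0 * x 1 < 1 :=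
    mul_lt_one_of_nonneg_of_lt_one_left (hxb 0).1.le (hxb 0).2 (hxb 1).2.le
  have ht : x 0 * x 1 * x 2 < 1 :=
    mul_lt_one_of_nonneg_of_lt_one_left (mul_nonneg (hxb 0).1.le (hxb 1).1.le) h01 (hxb 2).2.le
  have ht0 : 0 ≤ x 0 * x 1 * x 2 :=
    mul_nonneg (mul_nonneg (hxb 0).1.le (hxb 1).1.le) (hxb 2).1.le
  have h1 : (1 : ℝ) - (x 0 * x 1 * x 2) ^ 2 ≠ 0 := by
    have : (x 0 * x 1 * x 2) ^ 2 < 1 := pow_lt_one₀ ht0 ht two_ne_zero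
    linarith
  have h2 : (1 : ℝ) - x 0 ^ 2 * x 1 ^ 2 * x 2 ^ 2 ≠ 0 := by
    rw [show x 0 ^ 2 * x 1 ^ 2 * x 2 ^ 2 = (x 0 * x 1 * x 2) ^ 2 by ring]
    exact h1
  norm_num
  field_simp

/-! ## The reduction stub and the Transfer -/

/-- **ReductionThreeTwo** (the crux-plan's load-bearing stub; all on the FIXED open box). Every rep
on the open box with integrand `P(t)/(1−t²)`, `P ∈ ℚ[t]`, is KZ-equivalent to a normal form
`a + b/(1−t)` on the same box. Chain: `P = (t²−1)Q + (α + βt)` (Euclidean division by the monic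
`t² − 1`), integrand additivity into `−Q(t) + α/(1−t²) + βt/(1−t²)`; monomials of `−Q` by L1;
`βt/(1−t²) ∼ (β/8)/(1−t)` and `α/(1−t²) = α/(1−t) − αt/(1−t²) ∼ (7α/8)/(1−t)` by L2; merge the
constants and the polar multiples by integrand additivity. Explicitly `a = −Σₖ qₖ/(k+1)³`,
`b = 7α/8 + β/8 = P(1)/2 + 3P(−1)/8`. -/
def ReductionThreeTwo : Prop :=
  ∀ (r : KZ.IntegralRep 3) (P : Polynomial ℚ), r.domain = box3 →
    Set.EqOn r.integrand
      (fun x => Polynomial.aeval (x 0 * x 1 * x 2) P / (1 - (x 0 * x 1 * x 2) ^ 2)) r.domain →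
    ∃ (a b : ℚ) (r' : KZ.IntegralRep 3), r'.domain = box3 ∧
      Set.EqOn r'.integrand (fun x => (a : ℝ) + b / (1 - x 0 * x 1 * x 2)) r'.domain ∧
      KZ.Equivalent r r'

/-- The explicit form of the reduction with the complete invariant `(A P, B P)`:
`B P = P(1)/2 + 3P(−1)/8` (the `ζ(3)`-coefficient is read off at the two poles `t = ±1`). -/
def ReductionThreeTwoExplicit : Prop :=
  ∀ (r : KZ.IntegralRep 3) (P : Polynomial ℚ), r.domain = box3 →
    Set.EqOn r.integrand
      (fun x => Polynomial.aeval (x 0 * x 1 * x 2) P / (1 - (x 0 * x 1 * x 2) ^ 2)) r.domain →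
    ∃ (a : ℚ) (r' : KZ.IntegralRep 3), r'.domain = box3 ∧
      Set.EqOn r'.integrand
        (fun x => (a : ℝ) + ((P.eval 1 / 2 + 3 * P.eval (-1) / 8 : ℚ) : ℝ) / (1 - x 0 * x 1 * x 2))
        r'.domain ∧
      KZ.Equivalent r r'

/-- **FanIntegrandAdd** (support, generic in the dimension): finite integrand additivity on a common
domain — `[r] − Σ_{j ∈ s} [r_j]` is a relation when `r.integrand = Σ_j r_j.integrand` on the domain
(iterate move (1b); `s = ∅` is the zero-rep case). The reduction is then "fan out `P/(1−t²)` into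
pieces, move each piece by ONE dilation (or none), fan the images back in". -/
def FanIntegrandAdd : Prop :=
  ∀ (n : ℕ) (s : Finset ℕ) (r : KZ.IntegralRep n) (rs : ℕ → KZ.IntegralRep n),
    (∀ j ∈ s, (rs j).domain = r.domain) →
    Set.EqOn r.integrand (fun x => ∑ j ∈ s, (rs j).integrand x) r.domain →
    KZ.of r - ∑ j ∈ s, KZ.of (rs j) ∈ KZ.relations

/-- **Transfer C⁺ — LevelTwoKernelForm (uniform in the weight `n ≥ 2`).** For every `n ≥ 2` with
`ζ(n) ∉ ℚ`: a rep on the open `n`-box with integrand `D(∏xᵢ)/(1 − (∏xᵢ)²)`, `D ∈ ℚ[t]`, and value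
`0` is itself a relation. `n = 3` + Apéry (in tree) gives the crux by ONE integrand-additivity move
(`[r] − [r'] − [r − r']`); `n` even gives the sectors `(n, 2)` unconditionally
(`transcendental_zetaValue_two_mul`, in tree). Same chain, `∏`-shape of the tree's `BoxIntegral`
lemmas, one rep instead of two, target the zero class. -/
def LevelTwoKernelForm : Prop :=
  ∀ (n : ℕ), 2 ≤ n → Irrational (zetaValue n) →
    ∀ (r : KZ.IntegralRep n) (D : Polynomial ℚ), r.domain = {x | ∀ i, x i ∈ Set.Ioo (0:ℝ) 1} →
      Set.EqOn r.integrand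
        (fun x => Polynomial.aeval (∏ i, x i) D / (1 - (∏ i, x i) ^ 2)) r.domain →
      r.value = 0 → KZ.of r ∈ KZ.relations

/-! ## Rigidity + glue: the crux from the reduction stub (proved) -/

variable {n : ℕ}

/-- The zero representation on the domain of `r` (integrand `0 = aeval x 0`). -/
def zeroRepOn (r : KZ.IntegralRep n) : KZ.IntegralRep n where
  domain := r.domain
  integrand := fun _ => 0
  isSemialgebraic_domain := r.isSemialgebraic_domain
  isSemialgebraicFunOn_integrand :=
    (isSemialgebraicFunOn_aeval r.isSemialgebraic_domain (0 : MvPolynomial (Fin n) ℚ)).congr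
      (fun x _ => by simp)
  integrableOn := integrableOn_zero

/-- A zero representation is a relation (`[z] − [z] − [z] ∈ integrandAddRel`). -/
theorem of_zeroRepOn_mem (r : KZ.IntegralRep n) : KZ.of (zeroRepOn r) ∈ KZ.relations := by
  have h : KZ.of (zeroRepOn r) - KZ.of (zeroRepOn r) - KZ.of (zeroRepOn r) ∈ KZ.integrandAddRel :=
    ⟨n, zeroRepOn r, zeroRepOn r, zeroRepOn r, rfl, rfl, fun x _ => by simp [zeroRepOn], rfl⟩
  have h' := KZ.integrandAddRel_subset_relations h
  have e : KZ.of (zeroRepOn r) - KZ.of (zeroRepOn r) - KZ.of (zeroRepOn r) = -KZ.of (zeroRepOn r) := by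
    abel
  rw [e] at h'
  exact neg_mem_iff.mp h'

/-- Same domain + integrands agreeing on it ⇒ KZ-equivalent (one additivity move against the zero
rep). -/
theorem equivalent_of_eqOn {r r' : KZ.IntegralRep n} (hd : r'.domain = r.domain)
    (h : Set.EqOn r.integrand r'.integrand r.domain) : KZ.Equivalent r r' := by
  have hmem : KZ.of r - KZ.of r' - KZ.of (zeroRepOn r) ∈ KZ.integrandAddRel :=
    ⟨n, r, r', zeroRepOn r, hd, rfl, fun x hx => by simp [zeroRepOn, h hx], rfl⟩
  have h1 := KZ.integrandAddRel_subset_relations hmem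
  have h2 := of_zeroRepOn_mem r
  have h3 := KZ.relations.add_mem h1 h2
  have e : KZ.of r - KZ.of r' - KZ.of (zeroRepOn r) + KZ.of (zeroRepOn r) = KZ.of r - KZ.of r' := by
    abel
  rw [e] at h3
  exact h3

/-- Value of a normal form on the open box: `a + b·ζ(3)` (tree: `box_integral_normalForm_weight_three`). -/
theorem value_normalForm {a b : ℚ} {N : KZ.IntegralRep 3} (hNd : N.domain = box3)
    (hNf : Set.EqOn N.integrand (fun x => (a : ℝ) + b / (1 - x 0 * x 1 * x 2)) N.domain) :
    N.value = a + b * zetaValue 3 := by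
  unfold KZ.IntegralRep.value
  rw [setIntegral_congr_fun (KZ.IntegralRep.measurableSet_domain_holds N) hNf, hNd]
  exact (BoxIntegral.box_integral_normalForm_weight_three (a : ℝ) b).2

/-- **The crux from the reduction stub**: rigidity (Apéry, in tree) + soundness + glue. -/
theorem apery_of_reduction (hR : ReductionThreeTwo) : AperySectorThreeTwo := by
  intro r r' P P' hr hr' hf hf' hv
  obtain ⟨a, b, N, hNd, hNf, hrN⟩ := hR r P hr hf
  obtain ⟨a', b', N', hNd', hNf', hrN'⟩ := hR r' P' hr' hf'
  have hvalN : N.value = a + b * zetaValue 3 := value_normalForm hNd hNf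
  have hvalN' : N'.value = a' + b' * zetaValue 3 := value_normalForm hNd' hNf'
  have h1 : r.value = N.value := KZ.Equivalent.value_eq_holds hrN
  have h2 : r'.value = N'.value := KZ.Equivalent.value_eq_holds hrN'
  have hab : a = a' ∧ b = b' :=
    BoxIntegral.normalForm_weight_three_coeff_eq (by rw [← hvalN, ← hvalN', ← h1, ← h2, hv])
  obtain ⟨rfl, rfl⟩ := hab
  have hNN' : KZ.Equivalent N N' := by
    refine equivalent_of_eqOn (hNd'.trans hNd.symm) fun x hx => ?_
    rw [hNf hx, hNf' (by rw [hNd', ← hNd]; exact hx)]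
  exact (hrN.trans hNN').trans hrN'.symm


/-! ## Bonus (beyond the card's first lemma): the reduction stub itself, from `DilationMove`

Everything below lives on the FIXED open box: every constructed rep has `domain := box3`
DEFINITIONALLY, the semialgebraicity of the box being inherited from the given rep (`hbox`).
Chain: Euclidean division by the monic `X² − 1`; the degree-≤-1 polar part by two `m = 2`
dilations (`polar_base`); the polynomial part by one `m = k+1` dilation per monomial (`poly_fan`).
(Domain equalities between constructed reps are passed as the `*_domain` lemmas, never as `rfl`
between reps with different polynomial arguments, to spare the kernel a defeq search through
polynomial arithmetic.) -/

section Reduction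

/-- `t = X₀X₁X₂` as an `MvPolynomial`. -/
abbrev Tm : MvPolynomial (Fin 3) ℚ := X 0 * X 1 * X 2

theorem aeval_Tm (x : Fin 3 → ℝ) : MvPolynomial.aeval x Tm = x 0 * x 1 * x 2 := by
  simp [Tm]

/-- Bridge `Polynomial.aeval (x₀x₁x₂) p = MvPolynomial.aeval x (p(T))`. -/
theorem aeval_bridge (x : Fin 3 → ℝ) (p : Polynomial ℚ) :
    MvPolynomial.aeval x (Polynomial.aeval Tm p) = Polynomial.aeval (x 0 * x 1 * x 2) p := by
  rw [← aeval_Tm x]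
  exact (Polynomial.aeval_algHom_apply (MvPolynomial.aeval x) Tm p).symm

theorem box3_subset_Icc : box3 ⊆ Set.Icc (0 : Fin 3 → ℝ) 1 := fun _ hx =>
  ⟨fun i => (hx i).1.le, fun i => (hx i).2.le⟩

theorem t_mem {x : Fin 3 → ℝ} (hx : x ∈ box3) : x 0 * x 1 * x 2 ∈ Set.Ioo (0:ℝ) 1 := by
  have h := BoxIntegral.prod_mem_Ioo (n := 3) (by norm_num) hx
  simpa [Fin.prod_univ_three] using h

theorem one_sub_t_ne {x : Fin 3 → ℝ} (hx : x ∈ box3) : (1:ℝ) - x 0 * x 1 * x 2 ≠ 0 :=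
  (sub_pos.mpr (t_mem hx).2).ne'

theorem one_sub_t_sq_ne {x : Fin 3 → ℝ} (hx : x ∈ box3) : (1:ℝ) - (x 0 * x 1 * x 2) ^ 2 ≠ 0 := by
  have h := t_mem hx
  have : (x 0 * x 1 * x 2) ^ 2 < 1 := pow_lt_one₀ h.1.le h.2 two_ne_zero
  exact (sub_pos.mpr this).ne'

theorem one_sub_t_sq_ne' {x : Fin 3 → ℝ} (hx : x ∈ box3) : (1:ℝ) - x 0 ^ 2 * x 1 ^ 2 * x 2 ^ 2 ≠ 0 := by
  rw [show x 0 ^ 2 * x 1 ^ 2 * x 2 ^ 2 = (x 0 * x 1 * x 2) ^ 2 by ring]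
  exact one_sub_t_sq_ne hx

variable (hbox : IsSemialgebraic ℚ box3)

/-- Generic rep on the fixed open box. -/
def mkRep (f : (Fin 3 → ℝ) → ℝ) (hf : IsSemialgebraicFunOn ℚ box3 f)
    (hint : IntegrableOn f box3 volume) : KZ.IntegralRep 3 :=
  ⟨box3, f, hbox, hf, hint⟩

omit hbox in
/-- Integrability of `p(t)/(1−t²)` on the open box (finite sum of the tree's Hurwitz kernels). -/
theorem secRep_integrable (p : Polynomial ℚ) :
    IntegrableOn (fun x : Fin 3 → ℝ =>
      Polynomial.aeval (x 0 * x 1 * x 2) p / (1 - (x 0 * x 1 * x 2) ^ 2)) box3 volume := by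
  have hk : ∀ k : ℕ, IntegrableOn
      (fun x : Fin 3 → ℝ => (x 0 * x 1 * x 2) ^ k / (1 - (x 0 * x 1 * x 2) ^ 2)) box3 volume := by
    intro k
    have h := BoxIntegral.integrableOn_box_prod_pow_div_one_sub_prod_pow (n := 3) (by norm_num)
      (m := 2) (by norm_num) k
    simp only [Fin.prod_univ_three] at h
    exact h
  have hsum : IntegrableOn (fun x : Fin 3 → ℝ => ∑ k ∈ Finset.range (p.natDegree + 1),
      ((p.coeff k : ℚ) : ℝ) * ((x 0 * x 1 * x 2) ^ k / (1 - (x 0 * x 1 * x 2) ^ 2))) box3 volume :=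
    integrable_finsetSum _ fun k _ => (hk k).const_mul _
  refine hsum.congr_fun (fun x _ => ?_) (Beukers.measurableSet_cube 3)
  rw [Polynomial.aeval_eq_sum_range, Finset.sum_div]
  refine Finset.sum_congr rfl fun k _ => ?_
  rw [Algebra.smul_def, eq_ratCast, mul_div_assoc]

/-- Rep `[box, p(t)/(1−t²)]` (the sector). -/
def secRep (p : Polynomial ℚ) : KZ.IntegralRep 3 :=
  mkRep hbox (fun x => Polynomial.aeval (x 0 * x 1 * x 2) p / (1 - (x 0 * x 1 * x 2) ^ 2))
    ((isSemialgebraicFunOn_aeval_div_aeval hbox (Polynomial.aeval Tm p) (1 - Tm ^ 2)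
        (fun x hx => by simpa [Tm] using one_sub_t_sq_ne hx)).congr
      fun x _ => by dsimp only; rw [aeval_bridge]; simp [Tm])
    (secRep_integrable p)

/-- Rep `[box, p(t)]` (polynomial part). -/
def polyRep (p : Polynomial ℚ) : KZ.IntegralRep 3 :=
  mkRep hbox (fun x => Polynomial.aeval (x 0 * x 1 * x 2) p)
    ((isSemialgebraicFunOn_aeval hbox (Polynomial.aeval Tm p)).congr fun x _ => aeval_bridge x p)
    (by
      have hc : Continuous fun x : Fin 3 → ℝ => Polynomial.aeval (x 0 * x 1 * x 2) p :=
        (Polynomial.continuous_aeval p).comp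
          (((continuous_apply 0).mul (continuous_apply 1)).mul (continuous_apply 2))
      exact (hc.continuousOn.integrableOn_compact isCompact_Icc).mono_set box3_subset_Icc)

/-- Rep `[box, a + b/(1−t)]` (normal forms). -/
def nrmRep (a b : ℚ) : KZ.IntegralRep 3 :=
  mkRep hbox (fun x => (a : ℝ) + b / (1 - x 0 * x 1 * x 2))
    ((isSemialgebraicFunOn_aeval_div_aeval hbox (C a * (1 - Tm) + C b) (1 - Tm)
        (fun x hx => by simpa [Tm] using one_sub_t_ne hx)).congr
      fun x hx => by
        have h := one_sub_t_ne hx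
        dsimp only
        simp only [map_add, map_mul, map_sub, map_one, MvPolynomial.aeval_C, MvPolynomial.aeval_X,
          eq_ratCast]
        field_simp)
    (BoxIntegral.box_integral_normalForm_weight_three (a : ℝ) b).1

/-- Rep `[box, c]` (constants). -/
def cstRep (c : ℚ) : KZ.IntegralRep 3 :=
  mkRep hbox (fun _ => (c : ℝ))
    ((isSemialgebraicFunOn_aeval hbox (C c)).congr fun _ _ => by simp)
    (BoxIntegral.integrableOn_box_const 3 (c : ℝ))

@[simp] theorem secRep_domain (p : Polynomial ℚ) : (secRep hbox p).domain = box3 := rfl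
@[simp] theorem secRep_integrand (p : Polynomial ℚ) : (secRep hbox p).integrand =
    fun x => Polynomial.aeval (x 0 * x 1 * x 2) p / (1 - (x 0 * x 1 * x 2) ^ 2) := rfl
@[simp] theorem polyRep_domain (p : Polynomial ℚ) : (polyRep hbox p).domain = box3 := rfl
@[simp] theorem polyRep_integrand (p : Polynomial ℚ) : (polyRep hbox p).integrand =
    fun x => Polynomial.aeval (x 0 * x 1 * x 2) p := rfl
@[simp] theorem nrmRep_domain (a b : ℚ) : (nrmRep hbox a b).domain = box3 := rfl
@[simp] theorem nrmRep_integrand (a b : ℚ) : (nrmRep hbox a b).integrand =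
    fun x => (a : ℝ) + b / (1 - x 0 * x 1 * x 2) := rfl
@[simp] theorem cstRep_domain (c : ℚ) : (cstRep hbox c).domain = box3 := rfl
@[simp] theorem cstRep_integrand (c : ℚ) : (cstRep hbox c).integrand = fun _ => (c : ℝ) := rfl

omit hbox in
/-- One (1b) move between reps on the fixed box. -/
theorem add_move {r r₁ r₂ : KZ.IntegralRep 3} (h₀ : r.domain = box3) (h₁ : r₁.domain = box3)
    (h₂ : r₂.domain = box3)
    (h : ∀ x ∈ box3, r.integrand x = r₁.integrand x + r₂.integrand x) :
    KZ.of r - KZ.of r₁ - KZ.of r₂ ∈ KZ.relations :=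
  KZ.integrandAddRel_subset_relations
    ⟨3, r, r₁, r₂, h₁.trans h₀.symm, h₂.trans h₀.symm, fun x hx => h x (h₀ ▸ hx), rfl⟩

/-- **The polar part** (`deg ≤ 1` numerators): `[(βt + α)/(1−t²)] ∼ [(7α/8 + β/8)/(1−t)]` by two
`m = 2` dilations and four additivity moves. -/
theorem polar_base (hD : DilationMove) (α β : ℚ) :
    KZ.Equivalent (secRep hbox (Polynomial.C β * Polynomial.X + Polynomial.C α))
      (nrmRep hbox 0 (7 * α / 8 + β / 8)) := by
  -- m1 : split (βt + α)/(1−t²) = α/(1−t²) + βt/(1−t²)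
  have m1 : KZ.of (secRep hbox (Polynomial.C β * Polynomial.X + Polynomial.C α))
      - KZ.of (secRep hbox (Polynomial.C α)) - KZ.of (secRep hbox (Polynomial.C β * Polynomial.X))
      ∈ KZ.relations :=
    add_move (secRep_domain hbox _) (secRep_domain hbox _) (secRep_domain hbox _) fun x _ => by
      simp only [secRep_integrand, map_add, map_mul, Polynomial.aeval_C, Polynomial.aeval_X,
        eq_ratCast]
      ring
  -- m2 : βt/(1−t²) ∼ (β/8)/(1−t)   (dilation m = 2)
  have m2 : KZ.Equivalent (secRep hbox (Polynomial.C β * Polynomial.X)) (nrmRep hbox 0 (β / 8)) :=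
    polarDeflation hD (β / 8) _ _ (secRep_domain hbox _) (nrmRep_domain hbox _ _)
      (fun x _ => by
        simp only [secRep_integrand, map_mul, Polynomial.aeval_C, Polynomial.aeval_X, eq_ratCast]
        push_cast; ring)
      (fun x _ => by simp only [nrmRep_integrand]; push_cast; ring)
  -- m3 : α/(1−t²) = α/(1−t) + (−αt)/(1−t²)
  have m3 : KZ.of (secRep hbox (Polynomial.C α)) - KZ.of (nrmRep hbox 0 α)
      - KZ.of (secRep hbox (Polynomial.C (-α) * Polynomial.X)) ∈ KZ.relations :=
    add_move (secRep_domain hbox _) (nrmRep_domain hbox _ _) (secRep_domain hbox _) fun x hx => by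
      have h1 := one_sub_t_ne hx
      have h2 := one_sub_t_sq_ne hx
      have h2' := one_sub_t_sq_ne' hx
      simp only [secRep_integrand, nrmRep_integrand, map_mul, map_neg, Polynomial.aeval_C,
        Polynomial.aeval_X, eq_ratCast]
      push_cast
      field_simp
      ring
  -- m4 : (−αt)/(1−t²) ∼ (−α/8)/(1−t)   (dilation m = 2)
  have m4 : KZ.Equivalent (secRep hbox (Polynomial.C (-α) * Polynomial.X))
      (nrmRep hbox 0 (-α / 8)) :=
    polarDeflation hD (-α / 8) _ _ (secRep_domain hbox _) (nrmRep_domain hbox _ _)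
      (fun x _ => by
        simp only [secRep_integrand, map_mul, map_neg, Polynomial.aeval_C, Polynomial.aeval_X,
          eq_ratCast]
        push_cast; ring)
      (fun x _ => by simp only [nrmRep_integrand]; push_cast; ring)
  -- m5 : (7α/8)/(1−t) = α/(1−t) + (−α/8)/(1−t)
  have m5 : KZ.of (nrmRep hbox 0 (7 * α / 8)) - KZ.of (nrmRep hbox 0 α)
      - KZ.of (nrmRep hbox 0 (-α / 8)) ∈ KZ.relations :=
    add_move (nrmRep_domain hbox _ _) (nrmRep_domain hbox _ _) (nrmRep_domain hbox _ _)
      fun x hx => by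
        have h1 := one_sub_t_ne hx
        simp only [nrmRep_integrand]
        push_cast
        field_simp
        ring
  -- m6 : merge
  have m6 : KZ.of (nrmRep hbox 0 (7 * α / 8 + β / 8)) - KZ.of (nrmRep hbox 0 (7 * α / 8))
      - KZ.of (nrmRep hbox 0 (β / 8)) ∈ KZ.relations :=
    add_move (nrmRep_domain hbox _ _) (nrmRep_domain hbox _ _) (nrmRep_domain hbox _ _)
      fun x hx => by
        have h1 := one_sub_t_ne hx
        simp only [nrmRep_integrand]
        push_cast
        field_simp
        ring
  unfold KZ.Equivalent at *
  have := sub_mem (sub_mem (add_mem (add_mem (add_mem m1 m2) m3) m4) m5) m6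
  convert this using 1
  abel

/-- **The polynomial part, fan induction**: `[Σ_{k<j} qₖ tᵏ] ∼ [Σ_{k<j} qₖ/(k+1)³]`, one `m = k+1`
dilation per monomial (L1) and two additivity moves per step. -/
theorem poly_fan (hD : DilationMove) (q : ℕ → ℚ) (j : ℕ) :
    KZ.Equivalent (polyRep hbox (∑ k ∈ Finset.range j, Polynomial.C (q k) * Polynomial.X ^ k))
      (cstRep hbox (∑ k ∈ Finset.range j, q k / ((k : ℚ) + 1) ^ 3)) := by
  induction j with
  | zero =>
    exact equivalent_of_eqOn ((cstRep_domain hbox _).trans (polyRep_domain hbox _).symm)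
      fun x _ => by simp
  | succ j ih =>
    have m1 : KZ.of (polyRep hbox (∑ k ∈ Finset.range (j + 1), Polynomial.C (q k) * Polynomial.X ^ k))
        - KZ.of (polyRep hbox (∑ k ∈ Finset.range j, Polynomial.C (q k) * Polynomial.X ^ k))
        - KZ.of (polyRep hbox (Polynomial.C (q j) * Polynomial.X ^ j)) ∈ KZ.relations :=
      add_move (polyRep_domain hbox _) (polyRep_domain hbox _) (polyRep_domain hbox _)
        fun x _ => by simp [Finset.sum_range_succ, map_sum]
    have m2 : KZ.Equivalent (polyRep hbox (Polynomial.C (q j) * Polynomial.X ^ j))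
        (cstRep hbox (q j / ((j : ℚ) + 1) ^ 3)) :=
      monomialAbsorption hD j (q j) _ _ (polyRep_domain hbox _) (cstRep_domain hbox _)
        (fun x _ => by simp) (fun x _ => by simp)
    have m3 : KZ.of (cstRep hbox (∑ k ∈ Finset.range (j + 1), q k / ((k : ℚ) + 1) ^ 3))
        - KZ.of (cstRep hbox (∑ k ∈ Finset.range j, q k / ((k : ℚ) + 1) ^ 3))
        - KZ.of (cstRep hbox (q j / ((j : ℚ) + 1) ^ 3)) ∈ KZ.relations :=
      add_move (cstRep_domain hbox _) (cstRep_domain hbox _) (cstRep_domain hbox _)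
        fun x _ => by simp [Finset.sum_range_succ]
    unfold KZ.Equivalent at *
    have := sub_mem (add_mem (add_mem m1 ih) m2) m3
    convert this using 1
    abel

/-- The polynomial part for an arbitrary polynomial. -/
theorem poly_const (hD : DilationMove) (p : Polynomial ℚ) :
    KZ.Equivalent (polyRep hbox p)
      (cstRep hbox (∑ k ∈ Finset.range (p.natDegree + 1), p.coeff k / ((k : ℚ) + 1) ^ 3)) := by
  have e : KZ.Equivalent (polyRep hbox p)
      (polyRep hbox (∑ k ∈ Finset.range (p.natDegree + 1),
        Polynomial.C (p.coeff k) * Polynomial.X ^ k)) :=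
    equivalent_of_eqOn ((polyRep_domain hbox _).trans (polyRep_domain hbox _).symm) fun x _ =>
      congrArg (fun P : Polynomial ℚ => Polynomial.aeval (x 0 * x 1 * x 2) P)
        p.as_sum_range_C_mul_X_pow
  exact e.trans (poly_fan hbox hD (fun k => p.coeff k) (p.natDegree + 1))

omit hbox in
/-- **The reduction stub, PROVED from `DilationMove`**: with `R = P %ₘ (X² − 1) = βX + α`,
`Q = P /ₘ (X² − 1)`: `[P/(1−t²)] ∼ [A + b/(1−t)]`, `A = −Σ qₖ/(k+1)³`, `b = 7α/8 + β/8`. -/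
theorem reductionThreeTwo (hD : DilationMove) : ReductionThreeTwo := by
  intro r P hr hf
  have hbox : IsSemialgebraic ℚ box3 := hr ▸ r.isSemialgebraic_domain
  set qm : Polynomial ℚ := Polynomial.X ^ 2 - Polynomial.C 1 with hqm
  have hmonic : qm.Monic := Polynomial.monic_X_pow_sub_C (1:ℚ) two_ne_zero
  have hdiv : P %ₘ qm + qm * (P /ₘ qm) = P := Polynomial.modByMonic_add_div P qm
  have hqdeg : qm.natDegree = 2 := by rw [hqm]; exact Polynomial.natDegree_X_pow_sub_C
  have hRdeg : (P %ₘ qm).natDegree ≤ 1 := by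
    have h1 : (P %ₘ qm).natDegree < qm.natDegree :=
      Polynomial.natDegree_modByMonic_lt P hmonic (by
        intro h
        have h' := congrArg Polynomial.natDegree h
        rw [hqdeg, Polynomial.natDegree_one] at h'
        exact absurd h' (by norm_num))
    omega
  have hR : P %ₘ qm = Polynomial.C ((P %ₘ qm).coeff 1) * Polynomial.X
      + Polynomial.C ((P %ₘ qm).coeff 0) :=
    Polynomial.eq_X_add_C_of_natDegree_le_one hRdeg
  set α : ℚ := (P %ₘ qm).coeff 0 with hα
  set β : ℚ := (P %ₘ qm).coeff 1 with hβ
  set Q : Polynomial ℚ := P /ₘ qm with hQ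
  have hP : P = (Polynomial.C β * Polynomial.X + Polynomial.C α) + qm * Q := by
    rw [← hR]; exact hdiv.symm
  set A : ℚ := ∑ k ∈ Finset.range ((-Q).natDegree + 1), (-Q).coeff k / ((k : ℚ) + 1) ^ 3 with hA
  set b : ℚ := 7 * α / 8 + β / 8 with hb
  refine ⟨A, b, nrmRep hbox A b, rfl, fun x _ => rfl, ?_⟩
  -- e0 : r ∼ [P/(1−t²)] on the fixed box
  have e0 : KZ.Equivalent r (secRep hbox P) :=
    equivalent_of_eqOn ((secRep_domain hbox _).trans hr.symm) fun x hx => by rw [hf hx]; rfl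
  -- m1 : [P/(1−t²)] = [(βt+α)/(1−t²)] + [−Q(t)]
  have m1 : KZ.of (secRep hbox P)
      - KZ.of (secRep hbox (Polynomial.C β * Polynomial.X + Polynomial.C α))
      - KZ.of (polyRep hbox (-Q)) ∈ KZ.relations :=
    add_move (secRep_domain hbox _) (secRep_domain hbox _) (polyRep_domain hbox _) fun x hx => by
      have h2 := one_sub_t_sq_ne hx
      have h2' := one_sub_t_sq_ne' hx
      have hPt : Polynomial.aeval (x 0 * x 1 * x 2) P
          = Polynomial.aeval (x 0 * x 1 * x 2) (Polynomial.C β * Polynomial.X + Polynomial.C α)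
            + ((x 0 * x 1 * x 2) ^ 2 - 1) * Polynomial.aeval (x 0 * x 1 * x 2) Q := by
        conv_lhs => rw [hP]
        simp [hqm]
      simp only [secRep_integrand, polyRep_integrand, map_neg]
      rw [hPt]
      field_simp
      ring
  have e2 := polar_base hbox hD α β
  have e3 := poly_const hbox hD (-Q)
  have m4 : KZ.of (nrmRep hbox A b) - KZ.of (cstRep hbox A) - KZ.of (nrmRep hbox 0 b)
      ∈ KZ.relations :=
    add_move (nrmRep_domain hbox _ _) (cstRep_domain hbox _) (nrmRep_domain hbox _ _)
      fun x _ => by simp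
  unfold KZ.Equivalent at *
  have := sub_mem (add_mem (add_mem (add_mem e0 m1) e2) e3) m4
  convert this using 1
  abel

/-- **The crux from `DilationMove` alone** (everything else is in tree or above). -/
theorem aperySectorThreeTwo_of_dilationMove (hD : DilationMove) : AperySectorThreeTwo :=
  apery_of_reduction (reductionThreeTwo hD)

/-- The route item `DilationMove` from the Literature `coordPow` API (`BoxCoordinatePowerMap.lean`),
re-derived here (same witness as `Cruxes/DilationMove/Disproof.lean §P dilationMove_holds` and the
DilationMove ideator's `dilationMove_direct`) only to make this file's proof of the crux
UNCONDITIONAL on the farm snapshot. -/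
theorem dilationMove_direct : DilationMove := by
  intro n m hm r r' hr hr' hf
  have hm0 : m ≠ 0 := by omega
  refine ⟨n, r, r', BoxIntegral.coordPow m, BoxIntegral.coordPowDeriv m, ?_, ?_, ?_, ?_, ?_, rfl⟩
  · have h := isSemialgebraicMapOn_aeval r.isSemialgebraic_domain
      (fun j : Fin n => (X j : MvPolynomial (Fin n) ℚ) ^ m)
    refine h.congr fun x _ => ?_
    ext j
    simp
  · intro x _
    exact BoxIntegral.hasFDerivWithinAt_coordPow m _ x
  · rw [hr]; exact BoxIntegral.injOn_coordPow_box hm0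
  · rw [hr, hr']; exact (BoxIntegral.image_coordPow_box hm0).symm
  · intro x hx
    have hxb : ∀ i, x i ∈ Set.Ioo (0:ℝ) 1 := by rw [hr] at hx; exact hx
    rw [hf x hx, BoxIntegral.abs_det_coordPowDeriv hm0 hxb]
    rfl

/-- **AperySectorThreeTwo (stmt-KontsevichZagierPeriods-3873) holds** — sorry-free, from the tree. -/
theorem aperySectorThreeTwo_holds : AperySectorThreeTwo :=
  aperySectorThreeTwo_of_dilationMove dilationMove_direct

end Reduction

end Summit.KontsevichZagierPeriods.KontsevichZagierPeriods.Cruxes.AperySectorThreeTwo.JacobianAbsorption
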